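import Mathlib.Geometry.Manifold.Riemannian.Basic
import Mathlib.Geometry.Manifold.VectorBundle.Riemannian
import Mathlib.Geometry.Euclidean.Volume.Measure
import Mathlib.MeasureTheory.Constructions.BorelSpace.Basic
import Mathlib.MeasureTheory.Integral.Lebesgue.Basic
import Literature.Geometry.Lorentzian.PseudoRiemannianMetric
import HarnessLib

-- provenance: harness21/H21/H21/Prelude/Lorentz/Volume.lean @ b379dc0 (interim HEAD d8f2665); M5 mechanical rewrite
/-!
# Riemannian volume and area (trunk G08 = T-LORENTZ, item C9)

Given a `C^n` Riemannian metric `h` on the tangent bundle of a manifold `N` (a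
`Bundle.ContMDiffRiemannianMetric I n E (TangentSpace I : N → Type _)`), the **Riemannian volume**
of `N` in dimension `d` is the `d`-dimensional Hausdorff measure of the associated length (path)
metric `riemannianEDist`, normalised so that it agrees with Lebesgue measure on `ℝ^d`. For
`d = dim N` this is the Riemannian measure `dvol_h = √(det h_{ij}) dy¹ ⋯ dy^d` in charts; for
`d = 2` and `N` a surface it is the area, used downstream for areas of MOTS / horizons (Penrose
inequality, Hawking mass; notion `hypersurface_data_second_ff`).

## Mathlib

Everything is assembled from Mathlib:
* `Bundle.ContMDiffRiemannianMetric.toContinuousRiemannianMetric`,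
  `Bundle.ContinuousRiemannianMetric.toRiemannianMetric` and the instance
  `IsContinuousRiemannianBundle` that fires for `⟨h.toContinuousRiemannianMetric.toRiemannianMetric⟩`
  (`Mathlib/Topology/VectorBundle/Riemannian.lean`);
* `EMetricSpace.ofRiemannianMetric I N` (`Mathlib/Geometry/Manifold/Riemannian/Basic.lean`), the
  length metric of a Riemannian manifold, which needs `[T3Space N]` and `[IsManifold I 1 N]`;
* `MeasureTheory.Measure.euclideanHausdorffMeasure`, notation `μHE[d]` with `d : ℕ`
  (`Mathlib/Geometry/Euclidean/Volume/Measure.lean`).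

There is no Riemannian volume measure on manifolds in Mathlib
(`rg -i 'riemannianVolume|volume form' Mathlib/Geometry/Manifold` is empty).

## Design choices

* **Euclidean normalisation.** We use `μHE[d]`, *not* the plain Hausdorff measure `μH[d]`.
  Mathlib's `μH[d]` is normalised so that it agrees with Lebesgue measure for the *sup* metric on
  `Fin d → ℝ`; on the Euclidean space `EuclideanSpace ℝ (Fin d)` (and hence on any Riemannian
  manifold) it differs from the Riemannian measure by the factor `π^{d/2} / (2^d Γ(d/2+1))`
  (the volume of the Euclidean unit ball divided by the volume `2^d` of the sup-metric unit ball
  `[-1,1]^d`), so with `μH[d]` all areas of round spheres, horizons etc. would come out wrong by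
  this factor (review finding F1). `μHE[d]` rescales by exactly this Haar scalar factor
  (`MeasureTheory.Measure.euclideanHausdorffMeasure_def`), so `area` of the unit round `S²` is `4π`.
* **Measurable structure as a hypothesis.** As for `μHE` in Mathlib, `[MeasurableSpace N]
  [BorelSpace N]` are typeclass hypotheses rather than being manufactured from the topology via
  `borel N`; downstream structures carry these instances as fields.
* The `letI` spelling of `riemannianVolume` is fixed by the architect (probe verified) so that
  Mathlib's `IsContinuousRiemannianBundle` instance fires and `EMetricSpace.ofRiemannianMetric`
  elaborates.
* The dimension `d : ℕ` is a parameter (`area = riemannianVolume h 2`,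
  `riemannianMeasure = riemannianVolume h (finrank ℝ E)`); no finite-dimensionality of `E` is needed
  to *define* the measure.
* The chart formula `riemannianMeasure_eq_integral_sqrt_det` is stated for manifolds modelled on
  `EuclideanSpace ℝ (Fin m)` (any model with corners `I` on it, any `H`), via the Gram matrix
  `chartGramMatrix` of the coordinate vector fields `∂/∂yⁱ = D((extChartAt I x)⁻¹)(y) eᵢ`.

## References

* H. Federer, *Geometric Measure Theory*, Springer 1969, §2.10.2 (Hausdorff measure),
  §3.2.3 and §3.2.46 (area formula; Hausdorff measure of a Riemannian manifold equals the
  Riemannian volume).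
* J. M. Lee, *Introduction to Riemannian Manifolds*, 2nd ed., Springer 2018, Prop. 2.41 ff.
  (Riemannian volume, `dV_g = √(det g_{ij}) dy`), Ch. 2 (Riemannian distance).
* I. Chavel, *Riemannian Geometry: A Modern Introduction*, 2nd ed., CUP 2006, §III.3
  (Riemannian measure).
-/

open Manifold Bundle MeasureTheory Set
open scoped ContDiff Topology ENNReal

noncomputable section

namespace Literature.Geometry.Lorentzian

variable
  {E : Type*} [NormedAddCommGroup E] [NormedSpace ℝ E]
  {H : Type*} [TopologicalSpace H] {I : ModelWithCorners ℝ E H} {n : ℕ∞ω}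
  {N : Type*} [TopologicalSpace N] [ChartedSpace H N] [IsManifold I 1 N] [T3Space N]
  [MeasurableSpace N] [BorelSpace N]

/-- The **Riemannian volume in dimension `d`** of a manifold `N` carrying a `C^n` Riemannian
metric `h` on its tangent bundle: the Euclidean-normalised `d`-dimensional Hausdorff measure
`μHE[d]` of the Riemannian length metric `riemannianEDist` of `h` (the emetric structure
`EMetricSpace.ofRiemannianMetric I N`, whose topology is the given one). For `d = dim N` this is
the Riemannian measure (Federer 1969, §3.2.46; Chavel 2006, §III.3); for smaller `d` it measures
`d`-dimensional subsets (e.g. `d = 2`: area of surfaces in a `3`-manifold). [cite: Federer1969, §3.2.46] -/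
def riemannianVolume (h : ContMDiffRiemannianMetric I n E (TangentSpace I : N → Type _)) (d : ℕ) :
    Measure N := by
  letI : RiemannianBundle (fun x : N ↦ TangentSpace I x) :=
    ⟨h.toContinuousRiemannianMetric.toRiemannianMetric⟩
  letI : EMetricSpace N := EMetricSpace.ofRiemannianMetric I N
  exact μHE[d]

/-- The **area** of a subset `S ⊆ N` with respect to the Riemannian metric `h`: its
`2`-dimensional Euclidean-normalised Hausdorff measure for the length metric of `h`,
`area h S = riemannianVolume h 2 S`. For `N` a Riemannian surface this is the usual area
`∫_S √(det h_{ij}) dy¹ dy²` (Federer 1969, §3.2.3; Lee 2018, Prop. 2.41). [cite: Federer1969, §3.2.3] -/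
def area (h : ContMDiffRiemannianMetric I n E (TangentSpace I : N → Type _)) (S : Set N) : ℝ≥0∞ :=
  riemannianVolume h 2 S

/-- The **total area** of `N` with respect to `h`: `area h univ`. For a closed Riemannian
surface `(N, h)` this is `|N|_h = ∫_N dA_h` (Lee 2018, Prop. 2.41; e.g. the area `|S|` of a MOTS in
the Penrose inequality). [cite: Lee2018, Prop. 2.41] -/
def totalArea (h : ContMDiffRiemannianMetric I n E (TangentSpace I : N → Type _)) : ℝ≥0∞ :=
  area h univ

/-- The **Riemannian measure** `dvol_h` of `(N, h)`: the Riemannian volume in the top dimension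
`d = finrank ℝ E = dim N`, i.e. the Euclidean-normalised Hausdorff measure of dimension `dim N`
of the length metric. In charts it has density `√(det h_{ij})` with respect to Lebesgue measure
(`riemannianMeasure_eq_integral_sqrt_det`; Federer 1969, §3.2.46; Chavel 2006, §III.3). If `E` is
infinite-dimensional, `finrank ℝ E = 0` and this is the (junk) counting-type measure `μHE[0]`. [cite: Federer1969, §3.2.46] -/
def riemannianMeasure (h : ContMDiffRiemannianMetric I n E (TangentSpace I : N → Type _)) :
    Measure N :=
  riemannianVolume h (Module.finrank ℝ E)

/-- Unfolding lemma: `area h S = riemannianVolume h 2 S` (by definition). [folklore] -/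
@[simp]
theorem area_eq (h : ContMDiffRiemannianMetric I n E (TangentSpace I : N → Type _)) (S : Set N) :
    area h S = riemannianVolume h 2 S := rfl

/-- **Compact sets have finite Riemannian volume** in every dimension `d ≥ dim N`: if `K ⊆ N` is
compact then `riemannianVolume h d K < ∞`. (For `d = dim N` this is local finiteness of the
Riemannian measure; for `d > dim N` the measure vanishes. It fails for `d < dim N`, whence the
hypothesis `finrank ℝ E ≤ d`.) The proof goes through the local bi-Lipschitz comparison of the
length metric with the chart distance (Mathlib's `eventually_riemannianEDist_lt`,
`setOf_riemannianEDist_lt_subset_nhds`) and finiteness of `μHE[d]` on bounded subsets of `ℝ^m`,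
`m ≤ d`. Federer 1969, §2.10.11 and §3.2.46. [cite: Federer1969, §2.10.11 and §3.2.46] -/
def riemannianVolume_lt_top_of_isCompact : Prop :=
  ∀ [FiniteDimensional ℝ E] (h : ContMDiffRiemannianMetric I n E (TangentSpace I : N → Type _)) {d : ℕ} (hd : Module.finrank ℝ E ≤ d) {K : Set N} (hK : IsCompact K),
    riemannianVolume h d K < ⊤

section ChartFormula

variable {m : ℕ} {I : ModelWithCorners ℝ (EuclideanSpace ℝ (Fin m)) H} [IsManifold I 1 N]

/-- The **Gram matrix of a Riemannian metric in a chart.** For `N` modelled on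
`EuclideanSpace ℝ (Fin m)`, `x : N` and a point `y` of the model space, this is the matrix
`h_{ij}(y) = h_p(∂ᵢ, ∂ⱼ)` at `p = (extChartAt I x).symm y`, where the coordinate vectors are
`∂ᵢ = D((extChartAt I x).symm)(y) eᵢ` (derivative within `range I`, as everywhere in Mathlib's
manifold library) and `eᵢ = EuclideanSpace.single i 1` is the standard basis. Meaningful for
`y ∈ (extChartAt I x).target`; elsewhere it is a junk value. Lee 2018, (2.12) and Prop. 2.41. [cite: Lee2018, (2.12] -/
def chartGramMatrix (h : ContMDiffRiemannianMetric I n (EuclideanSpace ℝ (Fin m))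
      (TangentSpace I : N → Type _)) (x : N) (y : EuclideanSpace ℝ (Fin m)) :
    Matrix (Fin m) (Fin m) ℝ :=
  Matrix.of fun i j ↦
    h.inner ((extChartAt I x).symm y)
      (mfderivWithin 𝓘(ℝ, EuclideanSpace ℝ (Fin m)) I (extChartAt I x).symm (range I) y
        (EuclideanSpace.single i 1))
      (mfderivWithin 𝓘(ℝ, EuclideanSpace ℝ (Fin m)) I (extChartAt I x).symm (range I) y
        (EuclideanSpace.single j 1))

/-- **Chart formula for the Riemannian measure** (`dvol_h = √(det h_{ij}) dy`). If `N` is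
modelled on `EuclideanSpace ℝ (Fin m)` and `S` is a measurable subset of the domain of the
extended chart at `x`, then the Riemannian measure of `S` is the Lebesgue integral over the chart
image of `S` of `√(det h_{ij}(y))`, where `h_{ij}` is the Gram matrix `chartGramMatrix h x` of the
coordinate vector fields. This identifies the (Euclidean-normalised) Hausdorff measure of the
length metric with the classical Riemannian volume. Federer 1969, §3.2.3, §3.2.46; Lee 2018,
Prop. 2.41; Chavel 2006, §III.3. [cite: Federer1969, §3.2.3  §3.2.46] -/
def riemannianMeasure_eq_integral_sqrt_det : Prop :=
  ∀ (h : ContMDiffRiemannianMetric I n (EuclideanSpace ℝ (Fin m)) (TangentSpace I : N → Type _)) (x : N) {S : Set N} (hS : MeasurableSet S) (hSx : S ⊆ (extChartAt I x).source),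
    riemannianMeasure h S =
      ∫⁻ y in extChartAt I x '' S, ENNReal.ofReal (Real.sqrt (chartGramMatrix h x y).det)

end ChartFormula

end Literature.Geometry.Lorentzian

end
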